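import Literature.RepresentationTheory.TwistedCoinvariants
import HarnessLib

/-!
# Twisted coinvariants: restricting a diagonal tensor product along a group homomorphism

Topic `RepresentationTheory`; namespaces `Representation` (one `rfl` lemma on Mathlib's `Representation.tprod`) and
`Literature.RepresentationTheory.TwistedCoinv` (sequel of `TwistedCoinvariants`: `ker`, `Coinv`, `mk`, `rep`).  THEOREMS ONLY
(all by `rfl`); no definition, no named fact, no instance, no `sorry`.

`(ρ₁ ⊗ ρ₂) ∘ f = (ρ₁ ∘ f) ⊗ (ρ₂ ∘ f)` as representations (`Representation.tprod_comp`), hence the relation submodules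
(`ker_tprod_comp`), the coinvariant modules (`coinv_tprod_comp` — the same TYPE), the class maps (`mk_tprod_comp`) and the descended
actions (`rep_tprod_comp`) of the two spellings agree definitionally: a consumer holding coinvariants of `(ρ₁ ⊗ ρ₂) ∘ e` under `H′`
(e.g. along an isomorphism `e : E¹(𝔸_f) ≃ U(⟨a⟩)(𝔸_f)` of one torus with the unitary group of a hermitian line,
[GelbartRogawski1991] §3.1 Remark p. 457) may ascribe them to `(ρ₁ ∘ e) ⊗ (ρ₂ ∘ e)`.

## References
* [GelbartRogawski1991] S. Gelbart, J. Rogawski, Invent. Math. 105 (1991), §3.1 p. 454 and Remark p. 457 L4–13.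
-/

set_option autoImplicit false

noncomputable section

namespace Representation

open scoped TensorProduct

variable {k G H V W : Type*} [CommSemiring k] [Monoid G] [Monoid H] [AddCommMonoid V] [Module k V]
  [AddCommMonoid W] [Module k W] (ρ₁ : Representation k G V) (ρ₂ : Representation k G W) (f : H →* G)

/-- `(ρ₁ ⊗ ρ₂) ∘ f = (ρ₁ ∘ f) ⊗ (ρ₂ ∘ f)`. [cite: GelbartRogawski1991, §3.1 p. 454] -/
theorem tprod_comp : (ρ₁.tprod ρ₂).comp f = Representation.tprod (ρ₁.comp f) (ρ₂.comp f) :=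
  MonoidHom.ext fun _ => rfl

end Representation

namespace Literature.RepresentationTheory.TwistedCoinv

open scoped TensorProduct

variable {k : Type*} [CommRing k] {G H H' S₁ S₂ : Type*} [Group G] [Group H] [Group H']
  [AddCommGroup S₁] [Module k S₁] [AddCommGroup S₂] [Module k S₂]
  (ρ₁ : Representation k H S₁) (ρ₂ : Representation k H S₂) (f : H' →* H) (χ : H' →* kˣ)

/-- the relation submodules of `(ρ₁ ⊗ ρ₂) ∘ f` and `(ρ₁ ∘ f) ⊗ (ρ₂ ∘ f)` coincide (`rfl`). [cite: GelbartRogawski1991, §3.1 p. 454] -/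
theorem ker_tprod_comp : ker ((ρ₁.tprod ρ₂).comp f) χ = ker (Representation.tprod (ρ₁.comp f) (ρ₂.comp f)) χ := rfl

/-- hence the coinvariant modules are THE SAME TYPE (`rfl`): consumers may ascribe either spelling. [cite: GelbartRogawski1991, §3.1 p. 454] -/
theorem coinv_tprod_comp : Coinv ((ρ₁.tprod ρ₂).comp f) χ = Coinv (Representation.tprod (ρ₁.comp f) (ρ₂.comp f)) χ := rfl

/-- and the class maps agree (`rfl` after the type identification, stated with `mk` on both sides through `cast`-free `Eq.mpr`):
for every `x`, `mk ((ρ₁ ⊗ ρ₂) ∘ f) χ x = mk ((ρ₁ ∘ f) ⊗ (ρ₂ ∘ f)) χ x` as elements of the common type. [cite: GelbartRogawski1991, §3.1 p. 454] -/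
theorem mk_tprod_comp (x : S₁ ⊗[k] S₂) :
    (mk ((ρ₁.tprod ρ₂).comp f) χ x : Coinv (Representation.tprod (ρ₁.comp f) (ρ₂.comp f)) χ) = mk (Representation.tprod (ρ₁.comp f) (ρ₂.comp f)) χ x := rfl

/-- the descended `G`-actions agree too: for `σ` on `S₁ ⊗ S₂` commuting with both spellings, `rep χ σ _ g` is the same operator. [cite: GelbartRogawski1991, §3.1 p. 454] -/
theorem rep_tprod_comp (σ : Representation k G (S₁ ⊗[k] S₂))
    (hc : ∀ (g : G) (h : H'), Commute (σ g) (((ρ₁.tprod ρ₂).comp f) h))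
    (hc' : ∀ (g : G) (h : H'), Commute (σ g) ((Representation.tprod (ρ₁.comp f) (ρ₂.comp f)) h)) (g : G)
    (x : Coinv (Representation.tprod (ρ₁.comp f) (ρ₂.comp f)) χ) :
    (rep χ σ hc g x : Coinv (Representation.tprod (ρ₁.comp f) (ρ₂.comp f)) χ) = rep χ σ hc' g x := rfl

end Literature.RepresentationTheory.TwistedCoinv

end
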